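import Summits.SmoothPoincare4.SmoothPoincare4.Theorems.ConvexBisectionAcyclicBisectionExistsHurwitzMoveContract
import HarnessLib

/-!
# N1 ▸ `node_N1_move` ▸ (c₁) THE FREE SLICE MOVE: the CONTRACT `HC1 ⇐ (core) ∧ (seam) ∧ (iso)`
(wave 8, brick of stub `stub_M2geo` = node N1 of NF4 ▸ `node_N1_move_of_pieces (HC1) (HC2) (HD) (HE)`
(`…HurwitzMoveContract.lean`, p171574) ▸ hypothesis `HC1` = piece (c₁); line `modp-braid-orbits`, crux
`ConvexBisection.AcyclicBisectionExists`, item stmt-SmoothPoincare4-10508; worker J5, lead c5; design v3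
`work/design/N1_SliceMove_Design.lean`; registered sub-goal `helper_rigidRotation_mem_page`)

`HC1` (text: the first hypothesis of `node_N1_move_of_pieces`) drags the handle `k₀` of a fibred datum
`(X₀, bX, Ψ, X, G₀, h, D)` by a signed angle `ψ` (`0 < |ψ| < 2π`) through a sector of pages free of other
handles, along the rigid page rotation `R` (`w ∘ R_t = e^{it} w`).  Design v3 cuts it into THREE
stand-alone pieces, entering here as hypotheses:

* `HCORE` — **the Ψ-free re-digging** (H7's steps (ii) absorb-end, (iii) slab, (iv) dig-end in ONE
  statement over `(X, h, D)` alone): new attaching maps `h'` and a NEW multi-attachment datum `D'` of the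
  SAME manifold `X` (so `X' = X`, `G = refl`) whose `k₀`-th attaching circle is LITERALLY the rigidly
  rotated old one, `R ψ ∘ K`, the other circles and framings and the page twisting of `k₀` unchanged, and
  the SEAM/BELT DICHOTOMY of `(h', D')` against `(h, D)` (old seam points keep their `w`-ray, the old deep
  belt of `k₀` becomes seam on the ray of `d k₀`, the new deep belt of `k₀` comes from seam points on the
  ray of `d k₀ e^{iψ}`).  This is the honest XL node (a Kas slice, Gompf–Stipsicz §8.2 through
  Kosinski's gluing).
* `HSEAM` — **the seam bookkeeping** (LANDED separately, `piece_c1_seam`): the push-off `L = R ε ∘ K` into the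
  seam page of direction `d k₀ e^{iε}`, its seam presentation `(y, a)`, the RIGID TRANSPORT THROUGH `Ψ`
  by `ψ − ε` (`Ψ (y' θ) = R_{ψ−ε} (Ψ (y θ))`) read back on the base `(y', a', L')` — clauses 1–9 of `HC1`
  with `R₁ := R`, `τ₁ := ε`.
* `HISO` — **the isotopy realisation** (v3 form of H7's step (v) "normalisation"): an ambient isotopy
  `R₃` of `Base g` and a time `τ₃` with `R₃ τ₃ ∘ L' = R ψ ∘ K` — the loop read back from the
  `Ψ`-conjugated transport is ambient isotopic to the rigidly rotated circle (the two transports cover the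
  same free arc of page angles; on the seam they differ by a page-preserving isotopy).

Assembly (`piece_c1_of_subpieces`): `X' := X`, `G := Diffeomorph.refl`, `R₁ := R`, `τ₁ := ε`; the circle
clause `(h' k₀).attachingCircle θ = R₃ τ₃ (L' θ)` by `HCORE` + `HISO`; the page clause by
`helper_rigidRotation_mem_page` (§1: a rigid rotation carries `page g c` into `page g (c e^{it})`); the
dichotomy through `refl` is `HCORE`'s dichotomy.  Everything here is proved; the pieces enter as
hypotheses; no `sorry`.  Reference: R. E. Gompf, A. I. Stipsicz, *4-Manifolds and Kirby Calculus* (1999),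
§8.2 [GompfStipsicz1999]; A. A. Kosinski, *Differential Manifolds* (1993), VI §6 [Kosinski1993].
-/

noncomputable section

set_option linter.dupNamespace false

open scoped Manifold ContDiff Topology Real
open Set Function

namespace Summit.SmoothPoincare4.SmoothPoincare4.Theorems.AcyclicBisectionExists.ModpBraidOrbits

open Literature.GroupTheory.CombinatorialGroupTheory.SignedHurwitz
open Literature.Topology.FourManifolds Literature.Topology.FourManifolds.LefschetzBase
open Literature.Topology.FourManifolds.HandleAttachingMap

/-! ## §1 Rigid rotations carry pages to pages -/

/-- **Sub-goal `helper_rigidRotation_mem_page`** (fully qualified): a stage `R t` of an ambient isotopy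
of `Base g` with `w (R t x) = e^{it} w x` and `‖x‖² < 4 ↔ ‖x‖² < 4` (the rigid page rotation of
`helper_exists_rigidRotation`) carries the page of direction `c` into the page of direction `c e^{it}`.
[folklore] -/
theorem helper_rigidRotation_mem_page : ∀ (g : ℕ) (R : Literature.Topology.FourManifolds.AmbientIsotopy (𝓡∂ 4) (Literature.Topology.FourManifolds.LefschetzBase.Base g)), (∀ (t : ℝ) (x : Literature.Topology.FourManifolds.LefschetzBase.Base g), Literature.Topology.FourManifolds.LefschetzBase.w g (R.toFun t x).1 = Complex.exp ((t : ℂ) * Complex.I) * Literature.Topology.FourManifolds.LefschetzBase.w g x.1) → (∀ (t : ℝ) (x : Literature.Topology.FourManifolds.LefschetzBase.Base g), ‖Literature.Topology.FourManifolds.LefschetzBase.cx (R.toFun t x).1‖ ^ 2 < 4 ↔ ‖Literature.Topology.FourManifolds.LefschetzBase.cx x.1‖ ^ 2 < 4) → ∀ (t : ℝ) (c : ℂ) (x : Literature.Topology.FourManifolds.LefschetzBase.Base g), x ∈ Literature.Topology.FourManifolds.LefschetzBase.page g c → R.toFun t x ∈ Literature.Topology.FourManifolds.LefschetzBase.page g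 (c * Complex.exp ((t : ℂ) * Complex.I)) := by
  intro g R hRw hRcx t c x hx
  refine ⟨(hRcx t x).2 hx.1, ?_⟩
  rw [hRw t x, hx.2]
  ring

/-! ## §2 The contract `HC1 ⇐ (core) ∧ (seam) ∧ (iso)` -/

set_option maxHeartbeats 800000 in
-- three ∀-texts of 30–45 binders each as hypotheses and a 21-component witness
/-- **Piece (c₁) `HC1` of `node_N1_move_of_pieces` from its three sub-pieces** (design v3): the Ψ-free
re-digging `HCORE` (new datum of the same `X` with `k₀`-th circle `R ψ ∘ K` and the seam/belt dichotomy),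
the seam bookkeeping `HSEAM` (push-off, rigid transport through `Ψ`, read back) and the isotopy
realisation `HISO` (`R₃ τ₃ ∘ L' = R ψ ∘ K`).  The conclusion is the text of `HC1` VERBATIM; witnesses
`X' := X`, `G := refl`, `R₁ := R`, `τ₁ := ε`. [cite: GompfStipsicz1999, §8.2] -/
theorem piece_c1_of_subpieces
    (HCORE : ∀ (g n : ℕ) (X : Type) [TopologicalSpace X] [T2Space X] [SecondCountableTopology X] [CompactSpace X] [ChartedSpace (EuclideanHalfSpace 4) X] [IsManifold (𝓡∂ 4) ∞ X] (h : Fin n → HandleAttachingMap 3 2 (Base g)) (D : MultiAttachmentData h (𝓡∂ 4) X) (d : Fin n → ℂ), (∀ k, ‖d k‖ = 1) → (∀ k θ, (h k).attachingCircle θ ∈ page g (d k)) → ∀ (k₀ : Fin n) (ψ : ℝ) (R : AmbientIsotopy (𝓡∂ 4) (Base g)), ψ ≠ 0 → |ψ| < 2 * π → (∀ (t : ℝ) (x : Base g), rho g (R.toFun t x).1 = rho g x.1) → (∀ (t : ℝ) (x : Base g), w g (R.toFun t x).1 = Complex.exp ((t : ℂ) * Complex.I) * w g x.1) → (∀ (t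 : ℝ) (x : Base g), ‖cx (R.toFun t x).1‖ ^ 2 < 4 ↔ ‖cx x.1‖ ^ 2 < 4) → (∀ (t t' : ℝ) (x : Base g), R.toFun t (R.toFun t' x) = R.toFun (t + t') x) → (∀ k, k ≠ k₀ → ∀ t ∈ Set.Icc (0 : ℝ) 1, d k ≠ d k₀ * Complex.exp (((t * ψ : ℝ) : ℂ) * Complex.I)) → ∃ (h' : Fin n → HandleAttachingMap 3 2 (Base g)) (D' : MultiAttachmentData h' (𝓡∂ 4) X), (∀ θ, (h' k₀).attachingCircle θ = R.toFun ψ ((h k₀).attachingCircle θ)) ∧ (∀ k, k ≠ k₀ → (h' k).attachingCircle = (h k).attachingCircle ∧ (h' k).attachingFraming = (h k).attachingFraming) ∧ pageTwisting g (h' k₀).attachingCircle (h' k₀).attachingFraming = pageTwisting g (h k₀).attachingCircle (h k₀).attachingFraming ∧ (∀ a' : ↥(coresComplement h'), D'.jA a' ∈ (𝓡∂ 4).boundary X → (∃ a : ↥(coresComplement h), D'.jA a' = D.jA a ∧ ∃ c : ℝ, 0 < c ∧ w g (a' : Base g).1 = (c : ℂ) * w g (a : Base g).1) ∨ (∃ (k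 : Fin n) (b : ↥(beltPiece 3 2)), D'.jA a' = D.jB k b ∧ D'.jA a' ∉ range D.jA ∧ ∃ c : ℝ, 0 < c ∧ w g (a' : Base g).1 = (c : ℂ) * d k)) ∧ (∀ (k' : Fin n) (b' : ↥(beltPiece 3 2)), D'.jB k' b' ∉ range D'.jA → D'.jB k' b' ∈ (𝓡∂ 4).boundary X → (∃ a : ↥(coresComplement h), D'.jB k' b' = D.jA a ∧ ∃ c : ℝ, 0 < c ∧ w g (a : Base g).1 = (c : ℂ) * Function.update d k₀ (d k₀ * Complex.exp ((ψ : ℂ) * Complex.I)) k') ∨ (∃ (k : Fin n) (b : ↥(beltPiece 3 2)), D'.jB k' b' = D.jB k b ∧ D'.jB k' b' ∉ range D.jA ∧ d k = Function.update d k₀ (d k₀ * Complex.exp ((ψ : ℂ) * Complex.I)) k')))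
    (HSEAM : ∀ (g n : ℕ) (X₀ : Type) [TopologicalSpace X₀] [T2Space X₀] [SecondCountableTopology X₀] [CompactSpace X₀] [ChartedSpace (EuclideanHalfSpace 4) X₀] [IsManifold (𝓡∂ 4) ∞ X₀] (bX : BoundaryData (𝓡∂ 4) X₀ (𝓡 3)) (Ψ : bX.carrier ≃ₘ⟮𝓡 3, 𝓡 3⟯ (bBase g).carrier) (X : Type) [TopologicalSpace X] [T2Space X] [SecondCountableTopology X] [CompactSpace X] [ChartedSpace (EuclideanHalfSpace 4) X] [IsManifold (𝓡∂ 4) ∞ X] (G₀ : X₀ ≃ₘ⟮𝓡∂ 4, 𝓡∂ 4⟯ X) (h : Fin n → HandleAttachingMap 3 2 (Base g)) (D : MultiAttachmentData h (𝓡∂ 4) X) (d : Fin n → ℂ), (∀ k, ‖d k‖ = 1) → (∀ k θ, (h k).attachingCircle θ ∈ page g (d k)) → (∀ (y : bX.carrier) (a : ↥(coresComplement h)), G₀ (bX.incl y) = D.jA a → ∃ c : ℝ, 0 < c ∧ w g ((bBase g).incl (Ψ y)).1 = (c : ℂ) * w g (a : Base g).1) → (∀ (y : bX.carrier) (k : Fin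 n) (b : ↥(beltPiece 3 2)), G₀ (bX.incl y) = D.jB k b → G₀ (bX.incl y) ∉ range D.jA → ∃ c : ℝ, 0 < c ∧ w g ((bBase g).incl (Ψ y)).1 = (c : ℂ) * d k) → ∀ (k₀ : Fin n) (ψ : ℝ) (R : AmbientIsotopy (𝓡∂ 4) (Base g)), ψ ≠ 0 → |ψ| < 2 * π → (∀ (t : ℝ) (x : Base g), rho g (R.toFun t x).1 = rho g x.1) → (∀ (t : ℝ) (x : Base g), w g (R.toFun t x).1 = Complex.exp ((t : ℂ) * Complex.I) * w g x.1) → (∀ (t : ℝ) (x : Base g), ‖cx (R.toFun t x).1‖ ^ 2 < 4 ↔ ‖cx x.1‖ ^ 2 < 4) → (∀ (t t' : ℝ) (x : Base g), R.toFun t (R.toFun t' x) = R.toFun (t + t') x) → (∀ k, k ≠ k₀ → ∀ t ∈ Set.Icc (0 : ℝ) 1, d k ≠ d k₀ * Complex.exp (((t * ψ : ℝ) : ℂ) * Complex.I)) → ∃ (ε : ℝ) (L L' : Metric.sphere (0 : EuclideanSpace ℝ (Fin 2)) 1 → Base g) (y y' : Metric.sphere (0 : EuclideanSpace ℝ (Fin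 2)) 1 → bX.carrier) (a a' : Metric.sphere (0 : EuclideanSpace ℝ (Fin 2)) 1 → ↥(coresComplement h)), (0 < ε / ψ ∧ ε / ψ < 1) ∧ Continuous L ∧ Continuous L' ∧ (∀ θ, L θ = R.toFun ε ((h k₀).attachingCircle θ)) ∧ (∀ θ, L θ ∈ page g (d k₀ * Complex.exp ((ε : ℂ) * Complex.I))) ∧ (∀ θ, G₀ (bX.incl (y θ)) = D.jA (a θ)) ∧ (∀ θ, ((a θ : ↥(coresComplement h)) : Base g) = L θ) ∧ (∀ θ, (bBase g).incl (Ψ (y' θ)) = R.toFun (ψ - ε) ((bBase g).incl (Ψ (y θ)))) ∧ (∀ θ, G₀ (bX.incl (y' θ)) = D.jA (a' θ)) ∧ (∀ θ, ((a' θ : ↥(coresComplement h)) : Base g) = L' θ))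
    (HISO : ∀ (g n : ℕ) (X₀ : Type) [TopologicalSpace X₀] [T2Space X₀] [SecondCountableTopology X₀] [CompactSpace X₀] [ChartedSpace (EuclideanHalfSpace 4) X₀] [IsManifold (𝓡∂ 4) ∞ X₀] (bX : BoundaryData (𝓡∂ 4) X₀ (𝓡 3)) (Ψ : bX.carrier ≃ₘ⟮𝓡 3, 𝓡 3⟯ (bBase g).carrier) (X : Type) [TopologicalSpace X] [T2Space X] [SecondCountableTopology X] [CompactSpace X] [ChartedSpace (EuclideanHalfSpace 4) X] [IsManifold (𝓡∂ 4) ∞ X] (G₀ : X₀ ≃ₘ⟮𝓡∂ 4, 𝓡∂ 4⟯ X) (h : Fin n → HandleAttachingMap 3 2 (Base g)) (D : MultiAttachmentData h (𝓡∂ 4) X) (d : Fin n → ℂ), (∀ k, ‖d k‖ = 1) → (∀ k θ, (h k).attachingCircle θ ∈ page g (d k)) → (∀ (y : bX.carrier) (a : ↥(coresComplement h)), G₀ (bX.incl y) = D.jA a → ∃ c : ℝ, 0 < c ∧ w g ((bBase g).incl (Ψ y)).1 = (c : ℂ) * w g (a : Base g).1) → (∀ (y : bX.carrier) (k : Fin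 n) (b : ↥(beltPiece 3 2)), G₀ (bX.incl y) = D.jB k b → G₀ (bX.incl y) ∉ range D.jA → ∃ c : ℝ, 0 < c ∧ w g ((bBase g).incl (Ψ y)).1 = (c : ℂ) * d k) → ∀ (k₀ : Fin n) (ψ : ℝ) (R : AmbientIsotopy (𝓡∂ 4) (Base g)), ψ ≠ 0 → |ψ| < 2 * π → (∀ (t : ℝ) (x : Base g), rho g (R.toFun t x).1 = rho g x.1) → (∀ (t : ℝ) (x : Base g), w g (R.toFun t x).1 = Complex.exp ((t : ℂ) * Complex.I) * w g x.1) → (∀ (t : ℝ) (x : Base g), ‖cx (R.toFun t x).1‖ ^ 2 < 4 ↔ ‖cx x.1‖ ^ 2 < 4) → (∀ (t t' : ℝ) (x : Base g), R.toFun t (R.toFun t' x) = R.toFun (t + t') x) → (∀ k, k ≠ k₀ → ∀ t ∈ Set.Icc (0 : ℝ) 1, d k ≠ d k₀ * Complex.exp (((t * ψ : ℝ) : ℂ) * Complex.I)) → ∀ (ε : ℝ) (L L' : Metric.sphere (0 : EuclideanSpace ℝ (Fin 2)) 1 → Base g) (y y' : Metric.sphere (0 : EuclideanSpace ℝ (Fin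 2)) 1 → bX.carrier) (a a' : Metric.sphere (0 : EuclideanSpace ℝ (Fin 2)) 1 → ↥(coresComplement h)), (0 < ε / ψ ∧ ε / ψ < 1) → (∀ θ, L θ = R.toFun ε ((h k₀).attachingCircle θ)) → (∀ θ, G₀ (bX.incl (y θ)) = D.jA (a θ)) → (∀ θ, ((a θ : ↥(coresComplement h)) : Base g) = L θ) → (∀ θ, (bBase g).incl (Ψ (y' θ)) = R.toFun (ψ - ε) ((bBase g).incl (Ψ (y θ)))) → (∀ θ, G₀ (bX.incl (y' θ)) = D.jA (a' θ)) → (∀ θ, ((a' θ : ↥(coresComplement h)) : Base g) = L' θ) → ∃ (R₃ : AmbientIsotopy (𝓡∂ 4) (Base g)) (τ₃ : ℝ), ∀ θ, R₃.toFun τ₃ (L' θ) = R.toFun ψ ((h k₀).attachingCircle θ)) :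
    ∀ (g n : ℕ) (X₀ : Type) [TopologicalSpace X₀] [T2Space X₀] [SecondCountableTopology X₀] [CompactSpace X₀] [ChartedSpace (EuclideanHalfSpace 4) X₀] [IsManifold (𝓡∂ 4) ∞ X₀] (bX : BoundaryData (𝓡∂ 4) X₀ (𝓡 3)) (Ψ : bX.carrier ≃ₘ⟮𝓡 3, 𝓡 3⟯ (bBase g).carrier) (X : Type) [TopologicalSpace X] [T2Space X] [SecondCountableTopology X] [CompactSpace X] [ChartedSpace (EuclideanHalfSpace 4) X] [IsManifold (𝓡∂ 4) ∞ X] (G₀ : X₀ ≃ₘ⟮𝓡∂ 4, 𝓡∂ 4⟯ X) (h : Fin n → HandleAttachingMap 3 2 (Base g)) (D : MultiAttachmentData h (𝓡∂ 4) X) (d : Fin n → ℂ), (∀ k, ‖d k‖ = 1) → (∀ k θ, (h k).attachingCircle θ ∈ page g (d k)) → (∀ (y : bX.carrier) (a : ↥(coresComplement h)), G₀ (bX.incl y) = D.jA a → ∃ c : ℝ, 0 < c ∧ w g ((bBase g).incl (Ψ y)).1 = (c : ℂ) * w g (a : Base g).1) → (∀ (y : bX.carrier) (k : Fin n) (b :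 ↥(beltPiece 3 2)), G₀ (bX.incl y) = D.jB k b → G₀ (bX.incl y) ∉ range D.jA → ∃ c : ℝ, 0 < c ∧ w g ((bBase g).incl (Ψ y)).1 = (c : ℂ) * d k) → ∀ (k₀ : Fin n) (ψ : ℝ) (R : AmbientIsotopy (𝓡∂ 4) (Base g)), ψ ≠ 0 → |ψ| < 2 * π → (∀ (t : ℝ) (x : Base g), rho g (R.toFun t x).1 = rho g x.1) → (∀ (t : ℝ) (x : Base g), w g (R.toFun t x).1 = Complex.exp ((t : ℂ) * Complex.I) * w g x.1) → (∀ (t : ℝ) (x : Base g), ‖cx (R.toFun t x).1‖ ^ 2 < 4 ↔ ‖cx x.1‖ ^ 2 < 4) → (∀ (t t' : ℝ) (x : Base g), R.toFun t (R.toFun t' x) = R.toFun (t + t') x) → (∀ k, k ≠ k₀ → ∀ t ∈ Set.Icc (0 : ℝ) 1, d k ≠ d k₀ * Complex.exp (((t * ψ : ℝ) : ℂ) * Complex.I)) → ∃ (X' : Type) (_ : TopologicalSpace X') (_ : T2Space X') (_ : SecondCountableTopology X') (_ : CompactSpace X') (_ : ChartedSpace (EuclideanHalfSpace 4) X') (_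 : IsManifold (𝓡∂ 4) ∞ X') (h' : Fin n → HandleAttachingMap 3 2 (Base g)) (D' : MultiAttachmentData h' (𝓡∂ 4) X') (G : X ≃ₘ⟮𝓡∂ 4, 𝓡∂ 4⟯ X') (R₁ R₃ : AmbientIsotopy (𝓡∂ 4) (Base g)) (τ₁ τ₃ ε : ℝ) (L L' : Metric.sphere (0 : EuclideanSpace ℝ (Fin 2)) 1 → Base g) (y y' : Metric.sphere (0 : EuclideanSpace ℝ (Fin 2)) 1 → bX.carrier) (a a' : Metric.sphere (0 : EuclideanSpace ℝ (Fin 2)) 1 → ↥(coresComplement h)), (0 < ε / ψ ∧ ε / ψ < 1) ∧ Continuous L ∧ Continuous L' ∧ (∀ θ, L θ = R₁.toFun τ₁ ((h k₀).attachingCircle θ)) ∧ (∀ θ, L θ ∈ page g (d k₀ * Complex.exp ((ε : ℂ) * Complex.I))) ∧ (∀ θ, G₀ (bX.incl (y θ)) = D.jA (a θ)) ∧ (∀ θ, ((a θ : ↥(coresComplement h)) : Base g) = L θ) ∧ (∀ θ, (bBase g).incl (Ψ (y' θ)) = R.toFun (ψ - ε) ((bBase g).incl (Ψ (y θ)))) ∧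 (∀ θ, G₀ (bX.incl (y' θ)) = D.jA (a' θ)) ∧ (∀ θ, ((a' θ : ↥(coresComplement h)) : Base g) = L' θ) ∧ (∀ θ, (h' k₀).attachingCircle θ = R₃.toFun τ₃ (L' θ)) ∧ (∀ θ, (h' k₀).attachingCircle θ ∈ page g (d k₀ * Complex.exp ((ψ : ℂ) * Complex.I))) ∧ (∀ k, k ≠ k₀ → (h' k).attachingCircle = (h k).attachingCircle ∧ (h' k).attachingFraming = (h k).attachingFraming) ∧ pageTwisting g (h' k₀).attachingCircle (h' k₀).attachingFraming = pageTwisting g (h k₀).attachingCircle (h k₀).attachingFraming ∧ (∀ a' : ↥(coresComplement h'), G.symm (D'.jA a') ∈ (𝓡∂ 4).boundary X → (∃ a : ↥(coresComplement h), G.symm (D'.jA a') = D.jA a ∧ ∃ c : ℝ, 0 < c ∧ w g (a' : Base g).1 = (c : ℂ) * w g (a : Base g).1) ∨ (∃ (k : Fin n) (b : ↥(beltPiece 3 2)), G.symm (D'.jA a') = D.jB k b ∧ G.symm (D'.jA a') ∉ range D.jA ∧ ∃ c : ℝ, 0 < c ∧ w g (a' : Base g).1 = (c : ℂ) * d k))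 ∧ (∀ (k' : Fin n) (b' : ↥(beltPiece 3 2)), D'.jB k' b' ∉ range D'.jA → G.symm (D'.jB k' b') ∈ (𝓡∂ 4).boundary X → (∃ a : ↥(coresComplement h), G.symm (D'.jB k' b') = D.jA a ∧ ∃ c : ℝ, 0 < c ∧ w g (a : Base g).1 = (c : ℂ) * Function.update d k₀ (d k₀ * Complex.exp ((ψ : ℂ) * Complex.I)) k') ∨ (∃ (k : Fin n) (b : ↥(beltPiece 3 2)), G.symm (D'.jB k' b') = D.jB k b ∧ G.symm (D'.jB k' b') ∉ range D.jA ∧ d k = Function.update d k₀ (d k₀ * Complex.exp ((ψ : ℂ) * Complex.I)) k')) := by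
  intro g n X₀ _ _ _ _ _ _ bX Ψ X _ _ _ _ _ _ G₀ h D d hd hpg hseam hbelt k₀ ψ R hψ0 hψ hRρ hRw hRcx hRflow
    hfree
  obtain ⟨h', D', hcirc, hothers, htw, hO1, hO2⟩ :=
    HCORE g n X h D d hd hpg k₀ ψ R hψ0 hψ hRρ hRw hRcx hRflow hfree
  obtain ⟨ε, L, L', y, y', a, a', hε, hLc, hL'c, hL, hLp, hy, ha, hrel, hy', ha'⟩ :=
    HSEAM g n X₀ bX Ψ X G₀ h D d hd hpg hseam hbelt k₀ ψ R hψ0 hψ hRρ hRw hRcx hRflow hfree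
  obtain ⟨R₃, τ₃, hiso⟩ :=
    HISO g n X₀ bX Ψ X G₀ h D d hd hpg hseam hbelt k₀ ψ R hψ0 hψ hRρ hRw hRcx hRflow hfree ε L L' y y'
      a a' hε hL hy ha hrel hy' ha'
  refine ⟨X, inferInstance, inferInstance, inferInstance, inferInstance, inferInstance, inferInstance,
    h', D', Diffeomorph.refl (𝓡∂ 4) X ∞, R, R₃, ε, τ₃, ε, L, L', y, y', a, a', hε, hLc, hL'c, hL, hLp,
    hy, ha, hrel, hy', ha', fun θ => ?_, fun θ => ?_, hothers, htw, fun a' ha' => hO1 a' ha',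
    fun k' b' hdeep hb => hO2 k' b' hdeep hb⟩
  · rw [hcirc θ, hiso θ]
  · rw [hcirc θ]
    exact helper_rigidRotation_mem_page g R hRw hRcx ψ (d k₀) _ (hpg k₀ θ)

end Summit.SmoothPoincare4.SmoothPoincare4.Theorems.AcyclicBisectionExists.ModpBraidOrbits

end
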